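import Summits.BirchSwinnertonDyer.BirchSwinnertonDyer.Theorems.EisensteinPrimesCharResidualSelmerFinite
import Summits.BirchSwinnertonDyer.BirchSwinnertonDyer.Theorems.EisensteinPrimesResidualPairStableLine
import Summits.BirchSwinnertonDyer.BirchSwinnertonDyer.Theorems.UniversalToricDescentAcDualMuZeroCriterion
import Summits.BirchSwinnertonDyer.BirchSwinnertonDyer.Theorems.CumulativeHeegnerLeopoldtCumulativeHeegnerInclusionAtThreeBadPlacesSplitFinite
import Literature.NumberTheory.EllipticCurves.AnticyclotomicPrimeDecompositionAboveProofs
import HarnessLib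

/-!
# Keller–Yin Lemma 5.1.1 (member `f`: `𝔛^{Sf}_f` is `Λ`-torsion with `μ = 0`) FROM THE CHARACTER-LEVEL [RH] CLAUSES, AT ANY
# LOCAL TYPE — in particular at a SPLIT multiplicative Eisenstein prime
# (cell `bsd-eis`, width seat `bsd-line-x2-p2` gen 10; crux 4 `BSDpOnCellC` stmt-BirchSwinnertonDyer-19034, line b1 v12, stub
# `stub_lemma511` = `KellerYin2024.lemma511_imprimitive_isTorsion_muInvariant_eq_zero_mult_OPEN`)

HONEST FRAMING (run/shared/lean/pub/bsd-eis/): helper theorems only (0 defs, 0 named facts introduced, 0 sorry); `--supports -19034`, closes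
no registered stub (the registered `stub_lemma511` quantifies over every X2c datum with NO character-level hypothesis; here its CONCLUSION
is derived at every datum carrying a residual pair whose two `Sf`-imprimitive unramified duals are f.g. `Λ`-torsion with `μ = 0`); the
skeleton of record b1 v12 (sha256 155e218d…) is UNCHANGED (W-79); no summit statement / BSD / MC / IMC is proved; 0 cells / labels / tiers move.

## Why

Keller–Yin (arXiv:2402.12781v2 §5.1 L1744–1749) prove Lemma 5.1.1 by "essentially Thm. 1.4.1, since the proof only relies on the extension
`0 → 𝔽(φ) → ρ̄_f → 𝔽(ψ) → 0`; the characters can be arbitrary": the residual Selmer group of `E[p]` is squeezed between those of the two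
characters, whose finiteness is the `μ = 0` + torsion of the character duals (Rubin–Hida, KY Thm. 1.2.2 / Prop. 1.2.5). The lineage's gen 4
typed the NON-SPLIT half from CGLS Prop. 14 (`KellerYinLemma511NonsplitOfPrint`, p626493) and — anticipating the split half — the residual
dévissage WITHOUT the non-anomalous clause (`ResidualDevissageFiniteKernel.finite_selmerAc_pTorsion_of_line_devissage_of_finite`, finite
connecting-map kernel at `v̄`); the x1 LEAD g3 typed the Kummer/Pontryagin step (`CharResidualSelmerFinite.finite_residualStrictSelmer_of_dualData`:
ONE dual datum of `H¹_{𝓕_nr^{S}}(K_∞, (F/𝒪)(θ))` f.g. torsion `μ = 0` ⟹ `R_v̄^{S}(K_∞, 𝔽(θ̄))` finite) and the stable line of a residual pair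
with its two embeddings (`ResidualPairStableLine.exists_stableLine_of_isResidualPairOver`). This file COMPOSES them:

* §1 `finite_selmerAc_pTorsion_of_residualPair_of_dualData` / `isTorsion_muInvariant_eq_zero_of_residualPair_of_dualData` — over ANY number
  field `K`, elliptic `W/K`, ANY `ℤ_p`-extension `κ` with `v̄ ∋ p` finitely decomposed (`D_v̄ ⊄ ker κ`), a finite `S` off which (and off `p`) `W`
  has good reduction, a residual pair `(θsub, θquot)` of `W[p]` (`θ^{p−1} = 1`) and ONE dual datum over `S` of each character that is f.g.
  `Λ`-torsion with `μ = 0`: `Sel_v̄^{S}(K_∞, W[p^∞])[p]` is finite, hence `X_ac^{S}(W[p^∞])` is f.g. `Λ`-TORSION with `μ = 0` (Greenberg's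
  criterion (A), `UniversalToricDescentAcDualMuZero`). NO local-type hypothesis at `v̄`, NO «E(K)[p] = 0», NO orientation.
* §2 `lemma511_conclusion_of_residualPair_of_dualData` — line b1's currency: `W/ℚ` globally minimal, `p` odd, `K` imaginary quadratic with
  `(p)` split, `v̄ ∋ p`, `κ` anticyclotomic (Brink: `D_v̄ ⊄ ker κ`), `Sf` = the places over `N_W` off `p` (b1's binder; good reduction off
  `Sf ∪ {w ∣ p}` from the conductor), a residual pair of `E_K[p]` with the two [RH]^{Sf} clauses ⟹ the CONCLUSION of `stub_lemma511` at this
  datum. Neither `Mult`, nor (Heeg), nor `d_K` odd is needed.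

CONSEQUENCE (companion file `…BSDpOnCellCImprimitiveCountSplitOfBr`): in this seat's split wall `SplitMultWall.imprimitiveCount_split_of_an_of_br_of_pub`
(p677176) the hypothesis `h511` (KY Lemma 5.1.1 BY NAME, PREPRINT) is REDUNDANT — [BR𝟙] and [BRω-split] already carry [RH] for the two
characters, and this seat's `SplitMultCharImprimitiveShift.imprimitive_clauses_of_split` moves [RH] from `∅` to `Sf`.

References: [KellerYin2024] Lemma 5.1.1 (arXiv:2402.12781v2 §5.1 TeX L1744–1749), Thm. 1.2.2 (L676–683), Lemma 1.2.4, Prop. 1.2.5 (L780–800),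
Thm. 1.4.1 (L1087–1098); [CastellaGrossiLeeSkinner2022] §1.4 Props. 17–18 (arXiv:2008.02571); [GreenbergLNM1716] §1 p. 60; [GreenbergVatsal2000]
§2 Prop. (2.8); [LimSujatha2018] §3 Prop. 3.2; [Brink2007] Cor. 1; [SilvermanAEC2009] Prop. VII.5.4 (b); cell p626493, p629299, p632682 (the
three composed theorems' files).
-/

set_option autoImplicit false
set_option linter.dupNamespace false -- the summit namespace `…BirchSwinnertonDyer.BirchSwinnertonDyer.Theorems` (Sub = Summit, D-0017) trips it

noncomputable section

open scoped Classical

namespace Summit.BirchSwinnertonDyer.BirchSwinnertonDyer.Theorems.KellerYinLemma511OfCharRH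

open NumberField IsDedekindDomain Field WeierstrassCurve
open Literature.NumberTheory.EllipticCurves Literature.NumberTheory.EllipticCurves.GreenbergSelmer
  Literature.NumberTheory.EllipticCurves.GreenbergVatsal2000 Literature.NumberTheory.GaloisRepresentations
  Literature.NumberTheory.EllipticCurves.KellerYin2024 Literature.NumberTheory.IwasawaTheory
  Literature.NumberTheory.EllipticCurves.Rank1Residual
  Summit.BirchSwinnertonDyer.Rank1Residual.X11b Summit.BirchSwinnertonDyer.Rank1Residual.X11b.AcSelmer
  Summit.BirchSwinnertonDyer.Rank1Residual.X2.ResidualDevissageModules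
  Summit.BirchSwinnertonDyer.BirchSwinnertonDyer.Theorems

/-! ### §1 Any number field, any `ℤ_p`-extension with `v̄` finitely decomposed -/

section General

variable {K : Type} [Field K] [NumberField K] (W : WeierstrassCurve K) [W.IsElliptic] {p : ℕ} [hp : Fact p.Prime]
  (κ : ZpExtension K p) (γ : absoluteGaloisGroup K)

/-- **`Sel_v̄^{S}(K_∞, W[p^∞])[p]` is finite from ONE good dual datum of each character of a residual pair.** `W/K` elliptic over a
number field, `κ` any `ℤ_p`-extension, `v̄ ∋ p` with `D_v̄ ⊄ ker κ`, `S` finite with good reduction off `S ∪ {w ∣ p}`, `(θsub, θquot)` a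
residual pair of `W[p]` with `θ^{p−1} = 1`, `Dsub`/`Dquot` dual data of `H¹_{𝓕_nr^{S}}(K_∞, (F/𝒪)(θ))` that are f.g. `Λ`-torsion with
`μ = 0`: then `{s ∈ Sel_v̄^{S}(K_∞, W[p^∞]) ∣ p s = 0}` is finite. The residual dévissage along the stable line (finite connecting-map
kernel, no non-anomalous clause) fed by Kummer/Pontryagin for the two characters.
[cite: KellerYin2024, Lemma 5.1.1 and Thm. 1.4.1 (arXiv:2402.12781v2 §5.1 L1744–1749, §1.4 L1087–1098), Lemma 1.2.4, Prop. 1.2.5]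
[cite: CastellaGrossiLeeSkinner2022, §1.4 Props. 17–18 (arXiv:2008.02571)] [cite: LimSujatha2018, §3 Prop. 3.2] -/
theorem finite_selmerAc_pTorsion_of_residualPair_of_dualData
    {vbar : HeightOneSpectrum (𝓞 K)} (hvbar : ((p : ℕ) : 𝓞 K) ∈ vbar.asIdeal)
    (hdec : ¬ (decomp vbar ≤ κ.kerSubgroup)) {S : Set (HeightOneSpectrum (𝓞 K))}
    (hgood : ∀ v : HeightOneSpectrum (𝓞 K), v ∉ S → ((p : ℕ) : 𝓞 K) ∉ v.asIdeal → W.HasGoodReductionAt v)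
    {θsub θquot : FramedGaloisRep K (padicCoeffIntegers (∅ : Set (PadicAlgCl p))) 1}
    (hθsub : ∀ σ : absoluteGaloisGroup K, θsub σ ^ (p - 1) = 1)
    (hθquot : ∀ σ : absoluteGaloisGroup K, θquot σ ^ (p - 1) = 1)
    (hpair : IsResidualPairOver W p θsub θquot)
    (Dsub : DatumDualData κ γ (charModule (∅ : Set (PadicAlgCl p)) θsub)
      (Castella2018.AcSelmer.bdpData (charModule (∅ : Set (PadicAlgCl p)) θsub) p vbar) S)
    (Dquot : DatumDualData κ γ (charModule (∅ : Set (PadicAlgCl p)) θquot)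
      (Castella2018.AcSelmer.bdpData (charModule (∅ : Set (PadicAlgCl p)) θquot) p vbar) S)
    (hsub : Module.Finite (IwasawaAlgebra p) Dsub.X ∧ Module.IsTorsion (IwasawaAlgebra p) Dsub.X ∧
      muInvariant p Dsub.X = 0)
    (hquot : Module.Finite (IwasawaAlgebra p) Dquot.X ∧ Module.IsTorsion (IwasawaAlgebra p) Dquot.X ∧
      muInvariant p Dquot.X = 0) :
    Set.Finite {s : selmerAc W p κ vbar S | p • s = 0} := by
  -- the stable line of the residual pair with its two embeddings
  obtain ⟨Φ, -, -, ⟨jsub, hjsub, hinjsub, hrsub⟩, ⟨jquot, hjquot, hinjquot, hrquot⟩⟩ :=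
    ResidualPairStableLine.exists_stableLine_of_isResidualPairOver W hpair
  -- the residual groups of the two characters are finite (Kummer/Pontryagin)
  have hΦ : (datumStrictSelmer κ.kerSubgroup Φ.Sub p (AcSelmer.bdpData Φ.Sub p vbar) S :
      Set (Literature.NumberTheory.EllipticCurves.subgroupH1 κ.kerSubgroup Φ.Sub)).Finite :=
    CharResidualSelmerFinite.finite_residualStrictSelmer_of_dualData θsub κ vbar S hθsub jsub hjsub hinjsub hrsub Dsub
      hsub.1 hsub.2.1 hsub.2.2
  have hΨ : (datumStrictSelmer κ.kerSubgroup Φ.Quot p (AcSelmer.bdpData Φ.Quot p vbar) S :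
      Set (Literature.NumberTheory.EllipticCurves.subgroupH1 κ.kerSubgroup Φ.Quot)).Finite :=
    CharResidualSelmerFinite.finite_residualStrictSelmer_of_dualData θquot κ vbar S hθquot jquot hjquot hinjquot hrquot Dquot
      hquot.1 hquot.2.1 hquot.2.2
  -- the dévissage with finite connecting-map kernel
  exact ResidualDevissageFiniteKernel.finite_selmerAc_pTorsion_of_line_devissage_of_finite W κ hvbar hdec hgood Φ hΦ hΨ

/-- **`X_ac^{S}(W[p^∞])` is finitely generated `Λ`-TORSION with `μ = 0` from ONE good dual datum of each character of a residual pair**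
(same binders, `S` finite): the previous theorem + Greenberg's criterion (A) (`Sel[p]` finite ⟹ `X` torsion with `μ = 0`) on Castella's
object; finite generation is unconditional. Keller–Yin Lemma 5.1.1's conclusion / the cotorsion clauses of Thm. 1.4.1, at ANY local type
of the pair at `v̄` — in particular at a split multiplicative (anomalous) prime, for either orientation, with or without `K`-rational `p`-torsion.
[cite: KellerYin2024, Lemma 5.1.1 and Thm. 1.4.1 (arXiv:2402.12781v2)] [cite: GreenbergLNM1716, §1 p. 60] [cite: GreenbergVatsal2000, §2 Prop. (2.8)] -/
theorem isTorsion_muInvariant_eq_zero_of_residualPair_of_dualData [Fact (κ.IsTopGenerator γ)]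
    {vbar : HeightOneSpectrum (𝓞 K)} (hvbar : ((p : ℕ) : 𝓞 K) ∈ vbar.asIdeal)
    (hdec : ¬ (decomp vbar ≤ κ.kerSubgroup)) {S : Set (HeightOneSpectrum (𝓞 K))} (hS : S.Finite)
    (hgood : ∀ v : HeightOneSpectrum (𝓞 K), v ∉ S → ((p : ℕ) : 𝓞 K) ∉ v.asIdeal → W.HasGoodReductionAt v)
    {θsub θquot : FramedGaloisRep K (padicCoeffIntegers (∅ : Set (PadicAlgCl p))) 1}
    (hθsub : ∀ σ : absoluteGaloisGroup K, θsub σ ^ (p - 1) = 1)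
    (hθquot : ∀ σ : absoluteGaloisGroup K, θquot σ ^ (p - 1) = 1)
    (hpair : IsResidualPairOver W p θsub θquot)
    (Dsub : DatumDualData κ γ (charModule (∅ : Set (PadicAlgCl p)) θsub)
      (Castella2018.AcSelmer.bdpData (charModule (∅ : Set (PadicAlgCl p)) θsub) p vbar) S)
    (Dquot : DatumDualData κ γ (charModule (∅ : Set (PadicAlgCl p)) θquot)
      (Castella2018.AcSelmer.bdpData (charModule (∅ : Set (PadicAlgCl p)) θquot) p vbar) S)
    (hsub : Module.Finite (IwasawaAlgebra p) Dsub.X ∧ Module.IsTorsion (IwasawaAlgebra p) Dsub.X ∧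
      muInvariant p Dsub.X = 0)
    (hquot : Module.Finite (IwasawaAlgebra p) Dquot.X ∧ Module.IsTorsion (IwasawaAlgebra p) Dquot.X ∧
      muInvariant p Dquot.X = 0) :
    Module.Finite (IwasawaAlgebra p) (XAc W p κ vbar S γ) ∧ Module.IsTorsion (IwasawaAlgebra p) (XAc W p κ vbar S γ) ∧
      muInvariant p (XAc W p κ vbar S γ) = 0 := by
  have hfin := finite_selmerAc_pTorsion_of_residualPair_of_dualData W κ γ hvbar hdec hgood hθsub hθquot hpair Dsub Dquot
    hsub hquot
  exact ⟨XAc.module_finite κ vbar S γ hS (W := W),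
    UniversalToricDescentAcDualMuZero.isTorsion_of_finite_pTorsion W p κ vbar S γ hS hfin,
    UniversalToricDescentAcDualMuZero.muInvariant_eq_zero_of_finite_pTorsion W p κ vbar S γ hS hfin⟩

end General

/-! ### §2 Line b1's currency: `W/ℚ`, `K` imaginary quadratic, `(p)` split, anticyclotomic `κ`, `Sf` = places over `N_W` off `p` -/

section B1

variable {K : Type} [Field K] [NumberField K] {p : ℕ} [hp : Fact p.Prime]

omit hp in
/-- **Good reduction of `E_K` off `Sf ∪ {w ∣ p}`** for line b1's set `Sf` (`w ∈ Sf ↔ (N_W ∈ w ∧ p ∉ w)`): a bad place of `E_K` lies over a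
rational prime `ℓ ∣ N_W`, hence contains `N_W`. [cite: SilvermanAEC2009, Prop. VII.5.4 (b)] -/
theorem hasGoodReductionAt_of_notMem_of_b1 (W : WeierstrassCurve ℚ) [W.IsElliptic]
    (Sf : Finset (HeightOneSpectrum (𝓞 K)))
    (hSf : ∀ w : HeightOneSpectrum (𝓞 K), w ∈ Sf ↔
      (((W.conductorNorm ℤ : ℤ) : 𝓞 K) ∈ w.asIdeal ∧ ((p : ℕ) : 𝓞 K) ∉ w.asIdeal))
    (w : HeightOneSpectrum (𝓞 K)) (hw : w ∉ (↑Sf : Set (HeightOneSpectrum (𝓞 K))))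
    (hpw : ((p : ℕ) : 𝓞 K) ∉ w.asIdeal) : (W.baseChange K).HasGoodReductionAt w := by
  by_contra hbad
  obtain ⟨ℓ, -, hℓw, hℓN⟩ := CumulativeHeegnerInclusionAtThreeBadPlaces.exists_prime_mem_dvd_conductorNorm_of_not_hasGoodReductionAt W K w hbad
  apply hw
  rw [Finset.mem_coe, hSf]
  refine ⟨?_, hpw⟩
  obtain ⟨m, hm⟩ := hℓN
  rw [hm, Nat.cast_mul, Int.cast_mul, Int.cast_natCast]
  exact w.asIdeal.mul_mem_right _ hℓw

/-- **The CONCLUSION of Keller–Yin Lemma 5.1.1 (= line b1's `stub_lemma511`) at a datum carrying a residual pair with the two [RH]^{Sf}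
clauses.** `W/ℚ` globally minimal, `p` odd, `K` imaginary quadratic with `(p)` split, `v̄ ∋ p`, `κ` THE anticyclotomic `ℤ_p`-extension
with topological generator `γ` (Brink: `v̄` is finitely decomposed in `K_∞`), `Sf` = the places of `K` over `N_W` off `p`, `(θsub, θquot)` a
residual pair of `E_K[p]` (`θ^{p−1} = 1`), and ONE dual datum over `↑Sf` of each character f.g. `Λ`-torsion with `μ = 0` ⟹
`𝔛^{Sf}_f = X_ac^{Sf}(E_K[p^∞])` (strict at `v̄`) is f.g. `Λ`-torsion with `μ(𝔛^{Sf}_f) = 0`. Valid at EVERY local type: split or non-split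
multiplicative, good anomalous or not; no (Heeg), no `E(K)[p] = 0`, no orientation.
[cite: KellerYin2024, Lemma 5.1.1 (arXiv:2402.12781v2 §5.1 TeX L1744–1749), Thm. 1.2.2, Prop. 1.2.5] [cite: Brink2007, Cor. 1]
[cite: GreenbergLNM1716, §1 p. 60] [cite: CastellaGrossiLeeSkinner2022, §1.4 Props. 17–18] -/
theorem lemma511_conclusion_of_residualPair_of_dualData
    (W : WeierstrassCurve ℚ) [W.IsElliptic] [W.IsGloballyMinimal] (hp2 : p ≠ 2) (hK : IsImaginaryQuadratic K)
    {vbar : HeightOneSpectrum (𝓞 K)} (hvbar : ((p : ℕ) : 𝓞 K) ∈ vbar.asIdeal)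
    (κ : ZpExtension K p) (hκ : κ.IsAnticyclotomic) (γ : absoluteGaloisGroup K) [Fact (κ.IsTopGenerator γ)]
    (Sf : Finset (HeightOneSpectrum (𝓞 K)))
    (hSf : ∀ w : HeightOneSpectrum (𝓞 K), w ∈ Sf ↔
      (((W.conductorNorm ℤ : ℤ) : 𝓞 K) ∈ w.asIdeal ∧ ((p : ℕ) : 𝓞 K) ∉ w.asIdeal))
    {θsub θquot : FramedGaloisRep K (padicCoeffIntegers (∅ : Set (PadicAlgCl p))) 1}
    (hθsub : ∀ σ : absoluteGaloisGroup K, θsub σ ^ (p - 1) = 1)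
    (hθquot : ∀ σ : absoluteGaloisGroup K, θquot σ ^ (p - 1) = 1)
    (hpair : IsResidualPairOver (W.baseChange K) p θsub θquot)
    (Dsub : DatumDualData κ γ (charModule (∅ : Set (PadicAlgCl p)) θsub)
      (Castella2018.AcSelmer.bdpData (charModule (∅ : Set (PadicAlgCl p)) θsub) p vbar) (↑Sf : Set (HeightOneSpectrum (𝓞 K))))
    (Dquot : DatumDualData κ γ (charModule (∅ : Set (PadicAlgCl p)) θquot)
      (Castella2018.AcSelmer.bdpData (charModule (∅ : Set (PadicAlgCl p)) θquot) p vbar) (↑Sf : Set (HeightOneSpectrum (𝓞 K))))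
    (hsub : Module.Finite (IwasawaAlgebra p) Dsub.X ∧ Module.IsTorsion (IwasawaAlgebra p) Dsub.X ∧
      muInvariant p Dsub.X = 0)
    (hquot : Module.Finite (IwasawaAlgebra p) Dquot.X ∧ Module.IsTorsion (IwasawaAlgebra p) Dquot.X ∧
      muInvariant p Dquot.X = 0) :
    Module.Finite (IwasawaAlgebra p) (XAc (W.baseChange K) p κ vbar (↑Sf : Set (HeightOneSpectrum (𝓞 K))) γ) ∧
      Module.IsTorsion (IwasawaAlgebra p) (XAc (W.baseChange K) p κ vbar (↑Sf : Set (HeightOneSpectrum (𝓞 K))) γ) ∧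
      muInvariant p (XAc (W.baseChange K) p κ vbar (↑Sf : Set (HeightOneSpectrum (𝓞 K))) γ) = 0 := by
  haveI : (W.baseChange K).IsElliptic := inferInstanceAs (W.map (algebraMap ℚ K)).IsElliptic
  -- Brink: `v̄` is finitely decomposed in the anticyclotomic tower
  have hdec : ¬ (decomp vbar ≤ κ.kerSubgroup) :=
    ZpExtension.decomp_not_le_kerSubgroup_above_of_isAnticyclotomic_holds K p hK hp2 κ hκ vbar hvbar
  exact isTorsion_muInvariant_eq_zero_of_residualPair_of_dualData (W.baseChange K) κ γ hvbar hdec (Finset.finite_toSet Sf)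
    (hasGoodReductionAt_of_notMem_of_b1 W Sf hSf) hθsub hθquot hpair Dsub Dquot hsub hquot

end B1

end Summit.BirchSwinnertonDyer.BirchSwinnertonDyer.Theorems.KellerYinLemma511OfCharRH

end
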